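import Literature.Geometry.DiscreteGeometry.KissingRigidity
import Summits.AtomisticToContinuum.Crystallization.Theorems.SquareWellLayerCakeGapTwelveToBarlowFiveRingCensusDefs
import Summits.AtomisticToContinuum.Crystallization.Theorems.SquareWellLayerCakeGapTwelveToBarlowFiveFoldLinearChains

/-!
# Combinatorial layering (B1a of `GapTwelveToBarlow`): integer charts from the link census

Crux `SquareWellLayerCake.GapTwelveToBarlow` (stmt-AtomisticToContinuum-15807), line `Sketch`,
stub `stub_combinatorialLayering` (card B1a, energy-free): every site of a deep all-Good,
five-fold-free ball admits a combinatorial Barlow chart.  Wave 4 takes the ONE-SHELL LINK CENSUS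
`(S3δ)` of the census lane as hypothesis `P1` (the same `Prop` the sibling reduction
`…FiveFoldLinearOfParts` consumes): the twelve neighbours of a Good site carrying the local
`131/100` dichotomy are labelled by `e : Fin 12 → Fin N` so that bonds among them are EXACTLY the
cuboctahedron (`fccAdj`), the anticuboctahedron (`hcpAdj`) or the bicapped pentagonal prism
(`bppAdj`) contact graph.

This file turns a census labelling at a FIVE-FOLD-FREE site into an INTEGER CHART in the
format of the tree's transport machinery (`PalmUnimodularRigidityShellsToBarlowChartTransport*`:
labels in `ℤ³` of squared norm `18`, contacts = label pairs at squared distance `18`):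

* `fiveFold_of_bpp` — a bicapped-pentagonal-prism labelling exhibits a five-fold bond (the pole
  `e 0` and its ring `e 1, …, e 5`), so at a five-fold-free site the census leaves FCC / HCP;
* `exists_label_of_card_twelve` — an injective labelling into the neighbours of a site with
  exactly twelve neighbours is onto;
* `zchart_of_census` — census + five-fold-freeness ⇒ an integer chart `(T, e)`:
  `T = 3 • fccTab` or `T = hcpTab` (so `T a ∈ fcc3Int` resp. `hcpInt`), `e` injective onto the
  neighbours, and `dist ≤ 1 ↔ sqNormInt (T a - T b) = 18` among distinct labels;
* `zchart_of_deep` (anchor) — under (ExtendedGap) and `(S3δ)`, every site `j` with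
  `dist (x i) (x j) + 10 ≤ 2D` of an all-Good, five-fold-free `2D`-ball carries an integer chart;
  `zchart_of_deepCensus` — the same from the census in deep form `(S3δ-deep)`.

Mathlib + the Literature tables `fccTab`, `hcpTab` + the census lane's `bppAdj` + the landed
`localGap_of_deep`; no named fact is used, nothing is defined.
-/

namespace Summit.AtomisticToContinuum.Crystallization.Theorems.SquareWellLayerCakeGapTwelveToBarlow

open Literature.Geometry.DiscreteGeometry

/-! ## Two finite tables -/

/-- The cuboctahedral contact relation of the Literature table, rescaled to squared norm `18`:
`fccAdj a b ↔ |3 tₐ − 3 t_b|² = 18`. [folklore] -/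
theorem fccAdj_iff_sqNormInt_three (a b : Fin 12) :
    fccAdj a b ↔ sqNormInt (3 • fccTab a - 3 • fccTab b) = 18 := by
  revert a b
  decide

/-- The pole `0` of the bicapped pentagonal prism is adjacent exactly to its ring `1, …, 5`.
[folklore] -/
theorem bppAdj_zero_iff (b : Fin 12) :
    bppAdj ((0 : Fin 12) : ℕ) (b : ℕ) = true ↔ b ∈ ({1, 2, 3, 4, 5} : Finset (Fin 12)) := by
  revert b
  decide

/-! ## Labellings of a twelve-neighbour site -/

/-- An injective labelling `e : Fin 12 → Fin N` into the neighbours of a site with exactly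
twelve neighbours is onto the neighbours. [folklore] -/
theorem exists_label_of_card_twelve {N : ℕ} (x : Fin N → EuclideanSpace ℝ (Fin 3)) (j : Fin N)
    (hcard : (Finset.univ.filter fun j' : Fin N => j' ≠ j ∧ dist (x j) (x j') ≤ 1).card = 12)
    {e : Fin 12 → Fin N} (hinj : Function.Injective e)
    (hnb : ∀ a : Fin 12, e a ≠ j ∧ dist (x j) (x (e a)) ≤ 1)
    {k : Fin N} (hkj : k ≠ j) (hk : dist (x j) (x k) ≤ 1) : ∃ a : Fin 12, e a = k := by
  have hsub : Finset.univ.image e ⊆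
      Finset.univ.filter fun j' : Fin N => j' ≠ j ∧ dist (x j) (x j') ≤ 1 := by
    intro l hl
    rw [Finset.mem_image] at hl
    obtain ⟨a, -, rfl⟩ := hl
    rw [Finset.mem_filter]
    exact ⟨Finset.mem_univ _, hnb a⟩
  have hcardim : (Finset.univ.image e).card = 12 := by
    rw [Finset.card_image_of_injective _ hinj, Finset.card_univ, Fintype.card_fin]
  have heq := Finset.eq_of_subset_of_card_le hsub (by rw [hcard, hcardim])
  have hkmem : k ∈ Finset.univ.filter fun j' : Fin N => j' ≠ j ∧ dist (x j) (x j') ≤ 1 := by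
    rw [Finset.mem_filter]
    exact ⟨Finset.mem_univ _, hkj, hk⟩
  rw [← heq, Finset.mem_image] at hkmem
  obtain ⟨a, -, ha⟩ := hkmem
  exact ⟨a, ha⟩

/-- **A BPP labelling exhibits a five-fold bond.**  If the twelve neighbours of `j` are labelled
with bonds = the bicapped-pentagonal-prism contacts, then `(j, e 0)` is a five-fold bond: the
common neighbours of `j` and the pole `e 0` are exactly the ring `e 1, …, e 5`. [folklore] -/
theorem fiveFold_of_bpp {N : ℕ} (x : Fin N → EuclideanSpace ℝ (Fin 3)) (j : Fin N)
    (hcard : (Finset.univ.filter fun j' : Fin N => j' ≠ j ∧ dist (x j) (x j') ≤ 1).card = 12)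
    {e : Fin 12 → Fin N} (hinj : Function.Injective e)
    (hnb : ∀ a : Fin 12, e a ≠ j ∧ dist (x j) (x (e a)) ≤ 1)
    (hbpp : ∀ a b : Fin 12, a ≠ b → (dist (x (e a)) (x (e b)) ≤ 1 ↔ bppAdj a b = true)) :
    j ≠ e 0 ∧ dist (x j) (x (e 0)) ≤ 1 ∧
      (Finset.univ.filter fun l : Fin N =>
        l ≠ j ∧ l ≠ e 0 ∧ dist (x j) (x l) ≤ 1 ∧ dist (x (e 0)) (x l) ≤ 1).card = 5 := by
  refine ⟨(hnb 0).1.symm, (hnb 0).2, ?_⟩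
  have hset : (Finset.univ.filter fun l : Fin N =>
      l ≠ j ∧ l ≠ e 0 ∧ dist (x j) (x l) ≤ 1 ∧ dist (x (e 0)) (x l) ≤ 1) =
      ({1, 2, 3, 4, 5} : Finset (Fin 12)).image e := by
    ext l
    simp only [Finset.mem_filter, Finset.mem_univ, true_and, Finset.mem_image]
    constructor
    · rintro ⟨hlj, hl0, hjl, h0l⟩
      obtain ⟨a, rfl⟩ := exists_label_of_card_twelve x j hcard hinj hnb hlj hjl
      have ha0 : (0 : Fin 12) ≠ a := fun h => hl0 (by rw [h])
      exact ⟨a, (bppAdj_zero_iff a).1 ((hbpp 0 a ha0).1 h0l), rfl⟩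
    · rintro ⟨a, ha, rfl⟩
      have ha0 : (0 : Fin 12) ≠ a := by
        rintro rfl
        revert ha
        decide
      exact ⟨(hnb a).1, fun h => ha0 (hinj h).symm, (hnb a).2,
        (hbpp 0 a ha0).2 ((bppAdj_zero_iff a).2 ha)⟩
  rw [hset, Finset.card_image_of_injective _ hinj]
  decide

/-- **Integer chart from the census at a five-fold-free site.**  At a site `j` with exactly
twelve neighbours, a census labelling (bonds among the neighbours = `fccAdj`, `hcpAdj` or
`bppAdj` contacts) and no five-fold bond at `j` yield an INTEGER CHART `(T, e)`: the label table
`T` is `3 • fccTab` or `hcpTab` (twelve vectors of `ℤ³` of squared norm `18`), `e` is injective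
onto the neighbours of `j`, and two distinct labels are bonded iff their label vectors are at
squared distance `18`. [folklore] -/
theorem zchart_of_census {N : ℕ} (x : Fin N → EuclideanSpace ℝ (Fin 3)) (j : Fin N)
    (hcard : (Finset.univ.filter fun j' : Fin N => j' ≠ j ∧ dist (x j) (x j') ≤ 1).card = 12)
    (hcensus : ∃ e : Fin 12 → Fin N, Function.Injective e ∧
      (∀ a : Fin 12, e a ≠ j ∧ dist (x j) (x (e a)) ≤ 1) ∧
      ((∀ a b : Fin 12, a ≠ b → (dist (x (e a)) (x (e b)) ≤ 1 ↔ fccAdj a b)) ∨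
        (∀ a b : Fin 12, a ≠ b → (dist (x (e a)) (x (e b)) ≤ 1 ↔ hcpAdj a b)) ∨
        (∀ a b : Fin 12, a ≠ b → (dist (x (e a)) (x (e b)) ≤ 1 ↔ bppAdj a b = true))))
    (hff : ∀ k : Fin N, ¬ (j ≠ k ∧ dist (x j) (x k) ≤ 1 ∧
      (Finset.univ.filter fun l : Fin N =>
        l ≠ j ∧ l ≠ k ∧ dist (x j) (x l) ≤ 1 ∧ dist (x k) (x l) ≤ 1).card = 5)) :
    ∃ (T : Fin 12 → Fin 3 → ℤ) (e : Fin 12 → Fin N),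
      ((T = fun a : Fin 12 => 3 • fccTab a) ∨ T = hcpTab) ∧ Function.Injective e ∧
      (∀ a : Fin 12, e a ≠ j ∧ dist (x j) (x (e a)) ≤ 1) ∧
      (∀ k : Fin N, k ≠ j → dist (x j) (x k) ≤ 1 → ∃ a : Fin 12, e a = k) ∧
      (∀ a b : Fin 12, a ≠ b → (dist (x (e a)) (x (e b)) ≤ 1 ↔ sqNormInt (T a - T b) = 18)) := by
  obtain ⟨e, hinj, hnb, halt⟩ := hcensus
  have hsurj : ∀ k : Fin N, k ≠ j → dist (x j) (x k) ≤ 1 → ∃ a : Fin 12, e a = k :=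
    fun k hkj hk => exists_label_of_card_twelve x j hcard hinj hnb hkj hk
  rcases halt with hF | hH | hB
  · refine ⟨fun a => 3 • fccTab a, e, Or.inl rfl, hinj, hnb, hsurj, fun a b hab => ?_⟩
    rw [hF a b hab]
    exact fccAdj_iff_sqNormInt_three a b
  · exact ⟨hcpTab, e, Or.inr rfl, hinj, hnb, hsurj, fun a b hab => hH a b hab⟩
  · exact (hff (e 0) (fiveFold_of_bpp x j hcard hinj hnb hB)).elim

/-! ## Charts at the deep sites of an all-Good, five-fold-free ball -/

/-- **Integer charts at deep sites** (anchor of this file).  Under (ExtendedGap), if the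
one-shell link census `(S3δ)` holds at every Good site carrying the local `131/100` dichotomy,
then in an all-Good `2D`-ball about `x i` without five-fold bonds every site `j` with
`dist (x i) (x j) + 10 ≤ 2D` carries an integer chart `(T, e)` (`T = 3 • fccTab` or `hcpTab`,
`e : Fin 12 → Fin N` injective onto the neighbours of `j`, bonds among distinct labels ↔ label
vectors at squared distance `18`). [folklore] -/
theorem zchart_of_deep :
    (∀ (N : ℕ) (x : Fin N → EuclideanSpace ℝ (Fin 3)) (i j : Fin N), (∀ l : Fin N, dist (x i) (x
    l) ≤ 4 → ((∀ j' : Fin N, dist (x l) (x j') ≤ 11 / 10 → ∀ k : Fin N, k ≠ j' → (55 : ℝ) / 57 ≤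
    dist (x j') (x k)) ∧ (Finset.univ.filter fun j' : Fin N => j' ≠ l ∧ dist (x l) (x j') ≤
    1).card = 12 ∧ (Finset.univ.filter fun j' : Fin N => j' ≠ l ∧ dist (x l) (x j') ≤ 11 /
    10).card ≤ 12)) → 1 < dist (x i) (x j) → (131 : ℝ) / 100 ≤ dist (x i) (x j)) → (∀ (N : ℕ) (x
    : Fin N → EuclideanSpace ℝ (Fin 3)) (j : Fin N), ((∀ j' : Fin N, dist (x j) (x j') ≤ 11 / 10
    → ∀ k' : Fin N, k' ≠ j' → (55 : ℝ) / 57 ≤ dist (x j') (x k')) ∧ (Finset.univ.filter fun j' :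
    Fin N => j' ≠ j ∧ dist (x j) (x j') ≤ 1).card = 12 ∧ (Finset.univ.filter fun j' : Fin N =>
    j' ≠ j ∧ dist (x j) (x j') ≤ 11 / 10).card ≤ 12) → (∀ l l' : Fin N, dist (x j) (x l) ≤ 1 →
    dist (x j) (x l') ≤ 1 → 1 < dist (x l) (x l') → (131 : ℝ) / 100 ≤ dist (x l) (x l')) → ∃ e :
    Fin 12 → Fin N, Function.Injective e ∧ (∀ a : Fin 12, e a ≠ j ∧ dist (x j) (x (e a)) ≤ 1) ∧
    ((∀ a b : Fin 12, a ≠ b → (dist (x (e a)) (x (e b)) ≤ 1 ↔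
    Literature.Geometry.DiscreteGeometry.fccAdj a b)) ∨ (∀ a b : Fin 12, a ≠ b → (dist (x (e a))
    (x (e b)) ≤ 1 ↔ Literature.Geometry.DiscreteGeometry.hcpAdj a b)) ∨ (∀ a b : Fin 12, a ≠ b →
    (dist (x (e a)) (x (e b)) ≤ 1 ↔
    Summit.AtomisticToContinuum.Crystallization.Theorems.SquareWellLayerCakeGapTwelveToBarlow.bppAdj
    a b = true)))) → ∀ (N : ℕ) (x : Fin N → EuclideanSpace ℝ (Fin 3)) (i : Fin N) (D : ℝ), (∀ j
    : Fin N, dist (x i) (x j) ≤ 2 * D → ((∀ j' : Fin N, dist (x j) (x j') ≤ 11 / 10 → ∀ k : Fin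
    N, k ≠ j' → (55 : ℝ) / 57 ≤ dist (x j') (x k)) ∧ (Finset.univ.filter fun j' : Fin N => j' ≠
    j ∧ dist (x j) (x j') ≤ 1).card = 12 ∧ (Finset.univ.filter fun j' : Fin N => j' ≠ j ∧ dist
    (x j) (x j') ≤ 11 / 10).card ≤ 12)) → (∀ j k : Fin N, dist (x i) (x j) ≤ 2 * D → ¬ (j ≠ k ∧
    dist (x j) (x k) ≤ 1 ∧ (Finset.univ.filter fun l : Fin N => l ≠ j ∧ l ≠ k ∧ dist (x j) (x l)
    ≤ 1 ∧ dist (x k) (x l) ≤ 1).card = 5)) → ∀ j : Fin N, dist (x i) (x j) + 10 ≤ 2 * D → ∃ (T :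
    Fin 12 → Fin 3 → ℤ) (e : Fin 12 → Fin N), ((((T = fun a : Fin 12 => 3 •
    Literature.Geometry.DiscreteGeometry.fccTab a) ∨ T =
    Literature.Geometry.DiscreteGeometry.hcpTab) ∧ Function.Injective e ∧ (∀ a : Fin 12, e a ≠ j
    ∧ dist (x j) (x (e a)) ≤ 1) ∧ (∀ k : Fin N, k ≠ j → dist (x j) (x k) ≤ 1 → ∃ a : Fin 12, e a
    = k) ∧ (∀ a b : Fin 12, a ≠ b → (dist (x (e a)) (x (e b)) ≤ 1 ↔
    Literature.Geometry.DiscreteGeometry.sqNormInt (T a - T b) = 18)))) :=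
  fun hGap hCensus _ x i D hGood hFF j hj =>
    have hij : dist (x i) (x j) ≤ 2 * D := by linarith
    zchart_of_census x j (hGood j hij).2.1
      (hCensus _ x j (hGood j hij) (localGap_of_deep hGap x i D hGood j (by linarith)))
      (hFF j · hij)

/-- **Integer charts at deep sites, from the census in deep form** `(S3δ-deep)` (the shape any
multi-shell census bridges into): in an all-Good `2D`-ball about `x i` without five-fold bonds
every site `j` with `dist (x i) (x j) + 10 ≤ 2D` carries an integer chart. [folklore] -/
theorem zchart_of_deepCensus :
    (∀ (N : ℕ) (x : Fin N → EuclideanSpace ℝ (Fin 3)) (i : Fin N) (D : ℝ), (∀ j : Fin N, dist (x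
    i) (x j) ≤ 2 * D → ((∀ j' : Fin N, dist (x j) (x j') ≤ 11 / 10 → ∀ k : Fin N, k ≠ j' → (55 :
    ℝ) / 57 ≤ dist (x j') (x k)) ∧ (Finset.univ.filter fun j' : Fin N => j' ≠ j ∧ dist (x j) (x
    j') ≤ 1).card = 12 ∧ (Finset.univ.filter fun j' : Fin N => j' ≠ j ∧ dist (x j) (x j') ≤ 11 /
    10).card ≤ 12)) → ∀ j : Fin N, dist (x i) (x j) + 10 ≤ 2 * D → ∃ e : Fin 12 → Fin N,
    Function.Injective e ∧ (∀ a : Fin 12, e a ≠ j ∧ dist (x j) (x (e a)) ≤ 1) ∧ ((∀ a b : Fin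
    12, a ≠ b → (dist (x (e a)) (x (e b)) ≤ 1 ↔ Literature.Geometry.DiscreteGeometry.fccAdj a
    b)) ∨ (∀ a b : Fin 12, a ≠ b → (dist (x (e a)) (x (e b)) ≤ 1 ↔
    Literature.Geometry.DiscreteGeometry.hcpAdj a b)) ∨ (∀ a b : Fin 12, a ≠ b → (dist (x (e a))
    (x (e b)) ≤ 1 ↔
    Summit.AtomisticToContinuum.Crystallization.Theorems.SquareWellLayerCakeGapTwelveToBarlow.bppAdj
    a b = true)))) → ∀ (N : ℕ) (x : Fin N → EuclideanSpace ℝ (Fin 3)) (i : Fin N) (D : ℝ), (∀ j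
    : Fin N, dist (x i) (x j) ≤ 2 * D → ((∀ j' : Fin N, dist (x j) (x j') ≤ 11 / 10 → ∀ k : Fin
    N, k ≠ j' → (55 : ℝ) / 57 ≤ dist (x j') (x k)) ∧ (Finset.univ.filter fun j' : Fin N => j' ≠
    j ∧ dist (x j) (x j') ≤ 1).card = 12 ∧ (Finset.univ.filter fun j' : Fin N => j' ≠ j ∧ dist
    (x j) (x j') ≤ 11 / 10).card ≤ 12)) → (∀ j k : Fin N, dist (x i) (x j) ≤ 2 * D → ¬ (j ≠ k ∧
    dist (x j) (x k) ≤ 1 ∧ (Finset.univ.filter fun l : Fin N => l ≠ j ∧ l ≠ k ∧ dist (x j) (x l)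
    ≤ 1 ∧ dist (x k) (x l) ≤ 1).card = 5)) → ∀ j : Fin N, dist (x i) (x j) + 10 ≤ 2 * D → ∃ (T :
    Fin 12 → Fin 3 → ℤ) (e : Fin 12 → Fin N), ((((T = fun a : Fin 12 => 3 •
    Literature.Geometry.DiscreteGeometry.fccTab a) ∨ T =
    Literature.Geometry.DiscreteGeometry.hcpTab) ∧ Function.Injective e ∧ (∀ a : Fin 12, e a ≠ j
    ∧ dist (x j) (x (e a)) ≤ 1) ∧ (∀ k : Fin N, k ≠ j → dist (x j) (x k) ≤ 1 → ∃ a : Fin 12, e a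
    = k) ∧ (∀ a b : Fin 12, a ≠ b → (dist (x (e a)) (x (e b)) ≤ 1 ↔
    Literature.Geometry.DiscreteGeometry.sqNormInt (T a - T b) = 18)))) :=
  fun hCensusD _ x i D hGood hFF j hj =>
    have hij : dist (x i) (x j) ≤ 2 * D := by linarith
    zchart_of_census x j (hGood j hij).2.1 (hCensusD _ x i D hGood j hj) (hFF j · hij)

end Summit.AtomisticToContinuum.Crystallization.Theorems.SquareWellLayerCakeGapTwelveToBarlow
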